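import Summits.QuantumFields.YangMills.Theorems.BalabanLadderNTSubsequentialUnitModulus
import HarnessLib

/-!
# Crux `NT` (stmt-QuantumFields-19353): the UNIT MODULUS — under the collar bound NT's two functionals, read through the
# dilation family, are Lipschitz in the dilation parameter with `a'`-FREE constants (collar radius `R ≍ κ/a'β`)

Helper file (`--supports stmt-QuantumFields-19353`) of the fleet lead prover of crux `NT` (unit `ym-spine-19353-p1`, g29),
hypothesis-free; sequel of `…NTSubsequentialUnitModulus`, prepares `…NTSubsequentialUnitRobustness` (NT calibrates the unit only
up to bounded β-dependent factors, given the collar bound).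

* §1 small geometry/algebra: `disjoint_tsupport_of_dist`, `tsupport_subset_pos_of_gap`, **`collarRadius_spec`** (the collar radius
  `R = ⌊κ/s⌋ − 2` has `1 ≤ R`, `(R+2)s ≤ κ`, `κ/(2s) ≤ R` once `6s ≤ κ`), **`collar_pow_le`** (`(C/R⁴)ⁿ ≤ (16C/κ⁴)ⁿ(s⁴)ⁿ`);
* §2 **`unit_modulus_at`** — at one coupling on one torus, with `R ≍ κ/s`, the bounds of `abs_Q2_dilate_sub_le` /
  `abs_Q3_dilate_sub_le` become `s`-FREE: `(16C/κ⁴)²·2A'B'·|μ−ν|` and `(16C/κ⁴)³·3A'B'²·|μ−ν|`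
  (`A' = Lip(σ/m₁)(2σ/m₁+3)⁴`, `B' = M(2σ+3)⁴/m₁⁴`); **`exists_unit_modulus`** — from `MomentBounds G r a'` and compactly
  supported witnesses: constants `Mod`, `η₀`, a smallness `s₀`, a threshold and volume demands `Dm β` such that past the threshold,
  for `a'β ≤ s₀`, `L ≥ Dm β`, `μ, ν ∈ [m₁, m₂]`: `|Q2(μa'β)(θv,v) − Q2(νa'β)(θv,v)| ≤ Mod|μ−ν|` and, for `|μ−ν| ≤ η₀`,
  `||Q3(μa'β) f g h| − |Q3(νa'β) f g h|| ≤ Mod|μ−ν|` — the modulus consumed by `subseq_of_locLipschitzFamily`.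

HONEST FRAMING: finite-torus analysis; the collar bound is a HYPOTHESIS (the UV leg); nothing about `NT`, the gap, or Clay. [folklore]
-/

set_option autoImplicit false

noncomputable section

open scoped SchwartzMap
open MeasureTheory Filter Topology Set
open Literature.MathematicalPhysics.QuantumFieldTheory Literature.MathematicalPhysics.QuantumLattice
open Literature.Probability.LatticeModels
open Summit.QuantumFields.YangMills.Cruxes.OSLegsFromFemtoAndGap.DlrCollarTransfer
open Summit.QuantumFields.YangMills.Cruxes.UVSeamRec.UnitDilation
  (Q2_theta_compCLM Q3_compCLM exists_dilation tsupport_compCLM_subset_pos disjoint_tsupport_compCLM)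

namespace Summit.QuantumFields.YangMills.Cruxes.NT.Subsequential

/-! ## §1 Small geometry and collar algebra -/

/-- Functions whose charged points are at distance `≥ δ > 0` have disjoint topological supports. [folklore] -/
theorem disjoint_tsupport_of_dist {f g : EuclideanSpace ℝ (Fin 4) → ℝ} {δ : ℝ} (hδ : 0 < δ)
    (hfg : ∀ p q : EuclideanSpace ℝ (Fin 4), f p ≠ 0 → g q ≠ 0 → δ ≤ ‖p - q‖) :
    Disjoint (tsupport f) (tsupport g) := by
  rw [Set.disjoint_iff]
  rintro x ⟨hxf, hxg⟩
  obtain ⟨p, hp, hxp⟩ := Metric.mem_closure_iff.1 hxf (δ / 2) (by positivity)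
  obtain ⟨q, hq, hxq⟩ := Metric.mem_closure_iff.1 hxg (δ / 2) (by positivity)
  have h := hfg p q (Function.mem_support.1 hp) (Function.mem_support.1 hq)
  have h2 : ‖p - q‖ < δ := by
    calc ‖p - q‖ = dist p q := (dist_eq_norm p q).symm
      _ ≤ dist p x + dist x q := dist_triangle _ _ _
      _ < δ / 2 + δ / 2 := add_lt_add (by rwa [dist_comm]) hxq
      _ = δ := by ring
  exact absurd h (not_le.2 h2)

/-- A function charged only at times `≥ δ₀ > 0` is supported in positive time. [folklore] -/
theorem tsupport_subset_pos_of_gap {v : EuclideanSpace ℝ (Fin 4) → ℝ} {δ₀ : ℝ} (hδ₀ : 0 < δ₀)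
    (hv0 : ∀ p : EuclideanSpace ℝ (Fin 4), v p ≠ 0 → δ₀ ≤ p 0) :
    tsupport v ⊆ {y : EuclideanSpace ℝ (Fin 4) | 0 < y 0} := by
  have hcl : IsClosed {y : EuclideanSpace ℝ (Fin 4) | δ₀ ≤ y 0} :=
    isClosed_le continuous_const (PiLp.continuous_apply 2 _ (0 : Fin 4))
  have hsub : Function.support v ⊆ {y : EuclideanSpace ℝ (Fin 4) | δ₀ ≤ y 0} :=
    fun p hp => hv0 p (Function.mem_support.1 hp)
  exact (closure_minimal hsub hcl).trans fun y hy => lt_of_lt_of_le hδ₀ hy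

/-- **The collar radius `R = ⌊κ/s⌋ − 2`**: for `6s ≤ κ` it satisfies `1 ≤ R`, `(R+2)s ≤ κ`, `κ/(2s) ≤ R`. [folklore] -/
theorem collarRadius_spec {κ s : ℝ} (hs : 0 < s) (h6 : 6 * s ≤ κ) :
    1 ≤ ⌊κ / s⌋₊ - 2 ∧ (((⌊κ / s⌋₊ - 2 : ℕ) : ℝ) + 2) * s ≤ κ ∧ κ / (2 * s) ≤ ((⌊κ / s⌋₊ - 2 : ℕ) : ℝ) := by
  have hκs : 6 ≤ κ / s := by rw [le_div_iff₀ hs]; linarith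
  have hκ0 : 0 ≤ κ / s := by linarith
  have hfloor6 : 6 ≤ ⌊κ / s⌋₊ := Nat.le_floor (by exact_mod_cast hκs)
  have hcast : (((⌊κ / s⌋₊ - 2 : ℕ) : ℝ)) = (⌊κ / s⌋₊ : ℝ) - 2 := by
    rw [Nat.cast_sub (by omega)]; norm_num
  have hfl : (⌊κ / s⌋₊ : ℝ) ≤ κ / s := Nat.floor_le hκ0
  have hlt : κ / s < (⌊κ / s⌋₊ : ℝ) + 1 := Nat.lt_floor_add_one _
  refine ⟨by omega, ?_, ?_⟩
  · rw [hcast, sub_add_cancel]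
    calc (⌊κ / s⌋₊ : ℝ) * s ≤ κ / s * s := mul_le_mul_of_nonneg_right hfl hs.le
      _ = κ := div_mul_cancel₀ κ hs.ne'
  · rw [hcast]
    have h1 : κ / (2 * s) = (κ / s) / 2 := by rw [div_div, mul_comm]
    rw [h1]
    linarith

/-- **Collar algebra**: `κ/(2s) ≤ R`, `C ≥ 0` ⇒ `(C/R⁴)ⁿ ≤ (16C/κ⁴)ⁿ · (s⁴)ⁿ`. [folklore] -/
theorem collar_pow_le {C κ s R : ℝ} (hC : 0 ≤ C) (hκ : 0 < κ) (hs : 0 < s) (hR : κ / (2 * s) ≤ R) (n : ℕ) :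
    (C / R ^ 4) ^ n ≤ (16 * C / κ ^ 4) ^ n * (s ^ 4) ^ n := by
  have hR0 : 0 < κ / (2 * s) := by positivity
  have hRpos : 0 < R := hR0.trans_le hR
  rw [← mul_pow]
  refine pow_le_pow_left₀ (by positivity) ?_ n
  calc C / R ^ 4 ≤ C / (κ / (2 * s)) ^ 4 :=
        div_le_div_of_nonneg_left hC (by positivity) (pow_le_pow_left₀ hR0.le hR 4)
    _ = 16 * C / κ ^ 4 * s ^ 4 := by field_simp; ring

/-! ## §2 The unit modulus (explicit constants, then packaged) -/

section Transfer

variable {G : Type} [Group G] [TopologicalSpace G] [IsTopologicalGroup G] [CompactSpace G]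
  [MeasurableSpace G] [BorelSpace G]

/-- **The unit modulus at one coupling on one torus, explicit constants.**  Under the `n`-point collar bound at `(β, L, R)`
with `C ≥ 0` and a collar radius `R` with `κ/(2s) ≤ R`, `(R+2)s ≤ κ ≤ min(δ₀/m₂, δ/(8m₂))`: the dilates at parameters
`μ, ν ∈ [m₁, m₂]` of the witnesses satisfy `|Q2(s)(θv_μ,v_μ) − Q2(s)(θv_ν,v_ν)| ≤ (16C/κ⁴)²·2A'B'·|μ−ν|` and, for
`|μ−ν|σ/m₁ ≤ δ/2`, `|Q3(s)(f_μ,g_μ,h_μ) − Q3(s)(f_ν,g_ν,h_ν)| ≤ (16C/κ⁴)³·3A'B'²·|μ−ν|`, with `A' = Lip(σ/m₁)(2σ/m₁+3)⁴`,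
`B' = M(2σ+3)⁴/m₁⁴` — both `s`-FREE. [folklore] -/
theorem unit_modulus_at (r : LatticeRep G) (β : ℝ) (L : ℕ) {C κ s : ℝ} {R : ℕ} (hC : 0 ≤ C) (hκ : 0 < κ)
    (H : ∀ (n : ℕ) (x : Fin n → (Fin 4 → ℤ)),
      (∀ i j : Fin n, i ≠ j → ∃ k : Fin 4,
        (2 * (R : ℤ) + 4) ≤ |((((x i k - x j k : ℤ) : ZMod (2 * L + 1))).valMinAbs : ℤ)|) →
      |torusE G r β L (fun U => ∏ i, (dens G r (x i) U - torusE G r β L (dens G r (x i))))| ≤ (C / (R : ℝ) ^ 4) ^ n)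
    (hs : 0 < s) (hs1 : s ≤ 1) (hRge : κ / (2 * s) ≤ R) (hR2 : ((R : ℝ) + 2) * s ≤ κ)
    {v f g h : 𝓢(EuclideanSpace ℝ (Fin 4), ℝ)} {M Lip σ δ₀ δ m₁ m₂ μ ν : ℝ}
    (hMv : ∀ y : EuclideanSpace ℝ (Fin 4), |v y| ≤ M) (hMf : ∀ y : EuclideanSpace ℝ (Fin 4), |f y| ≤ M)
    (hMg : ∀ y : EuclideanSpace ℝ (Fin 4), |g y| ≤ M) (hMh : ∀ y : EuclideanSpace ℝ (Fin 4), |h y| ≤ M) (hLip0 : 0 ≤ Lip)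
    (hLv : ∀ x y : EuclideanSpace ℝ (Fin 4), |v x - v y| ≤ Lip * ‖x - y‖)
    (hLf : ∀ x y : EuclideanSpace ℝ (Fin 4), |f x - f y| ≤ Lip * ‖x - y‖)
    (hLg : ∀ x y : EuclideanSpace ℝ (Fin 4), |g x - g y| ≤ Lip * ‖x - y‖)
    (hLh : ∀ x y : EuclideanSpace ℝ (Fin 4), |h x - h y| ≤ Lip * ‖x - y‖) (hσ : 0 < σ)
    (hvσ : tsupport (v : EuclideanSpace ℝ (Fin 4) → ℝ) ⊆ Metric.closedBall 0 σ)
    (hfσ : tsupport (f : EuclideanSpace ℝ (Fin 4) → ℝ) ⊆ Metric.closedBall 0 σ)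
    (hgσ : tsupport (g : EuclideanSpace ℝ (Fin 4) → ℝ) ⊆ Metric.closedBall 0 σ)
    (hhσ : tsupport (h : EuclideanSpace ℝ (Fin 4) → ℝ) ⊆ Metric.closedBall 0 σ)
    (hδ₀ : 0 < δ₀) (hv0 : ∀ p : EuclideanSpace ℝ (Fin 4), v p ≠ 0 → δ₀ ≤ p 0) (hδ : 0 < δ)
    (hfg : ∀ p q : EuclideanSpace ℝ (Fin 4), f p ≠ 0 → g q ≠ 0 → δ ≤ ‖p - q‖)
    (hgh : ∀ p q : EuclideanSpace ℝ (Fin 4), g p ≠ 0 → h q ≠ 0 → δ ≤ ‖p - q‖)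
    (hfh : ∀ p q : EuclideanSpace ℝ (Fin 4), f p ≠ 0 → h q ≠ 0 → δ ≤ ‖p - q‖)
    (hκδ₀ : κ ≤ δ₀ / m₂) (hκδ : κ ≤ δ / (8 * m₂))
    (hm₁ : 0 < m₁) (hμ₁ : m₁ ≤ μ) (hμ₂ : μ ≤ m₂) (hν₁ : m₁ ≤ ν) (hν₂ : ν ≤ m₂) (hμs : μ * s ≤ 1) (hνs : ν * s ≤ 1)
    (hσL : 2 * (σ / m₁) ≤ s * L)
    (D₁ D₂ : EuclideanSpace ℝ (Fin 4) ≃L[ℝ] EuclideanSpace ℝ (Fin 4)) (hD₁ : ∀ x, D₁ x = μ • x) (hD₂ : ∀ x, D₂ x = ν • x) :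
    |Q2 G r β L s (thetaTest 4 (SchwartzMap.compCLMOfContinuousLinearEquiv ℝ D₁ v))
          (SchwartzMap.compCLMOfContinuousLinearEquiv ℝ D₁ v) -
        Q2 G r β L s (thetaTest 4 (SchwartzMap.compCLMOfContinuousLinearEquiv ℝ D₂ v))
          (SchwartzMap.compCLMOfContinuousLinearEquiv ℝ D₂ v)| ≤
        (16 * C / κ ^ 4) ^ 2 * (2 * ((Lip * (σ / m₁) * (2 * (σ / m₁) + 3) ^ 4) * (M * (2 * σ + 3) ^ 4 / m₁ ^ 4))) *
          |μ - ν| ∧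
      (|μ - ν| * (σ / m₁) ≤ δ / 2 →
        |Q3 G r β L s (SchwartzMap.compCLMOfContinuousLinearEquiv ℝ D₁ f) (SchwartzMap.compCLMOfContinuousLinearEquiv ℝ D₁ g)
              (SchwartzMap.compCLMOfContinuousLinearEquiv ℝ D₁ h) -
            Q3 G r β L s (SchwartzMap.compCLMOfContinuousLinearEquiv ℝ D₂ f)
              (SchwartzMap.compCLMOfContinuousLinearEquiv ℝ D₂ g) (SchwartzMap.compCLMOfContinuousLinearEquiv ℝ D₂ h)| ≤
          (16 * C / κ ^ 4) ^ 3 * (3 * ((Lip * (σ / m₁) * (2 * (σ / m₁) + 3) ^ 4) * (M * (2 * σ + 3) ^ 4 / m₁ ^ 4) ^ 2)) *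
            |μ - ν|) := by
  have hm₂ : 0 < m₂ := hm₁.trans_le (hμ₁.trans hμ₂)
  have hM0 : 0 ≤ M := (abs_nonneg _).trans (hMv 0)
  have hRδ₀ : ((R : ℝ) + 2) * s ≤ δ₀ / m₂ := hR2.trans hκδ₀
  have hRδ : 4 * ((R : ℝ) + 2) * s ≤ δ / (2 * m₂) := by
    have h1 : 4 * ((R : ℝ) + 2) * s ≤ 4 * κ := by
      have := hR2; nlinarith
    refine h1.trans ?_
    rw [le_div_iff₀ (by positivity)] at hκδ
    rw [le_div_iff₀ (by positivity)]
    have e : 4 * κ * (2 * m₂) = κ * (8 * m₂) := by ring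
    rw [e]; exact hκδ
  have hcol : ∀ n : ℕ, (C / (R : ℝ) ^ 4) ^ n ≤ (16 * C / κ ^ 4) ^ n * (s ^ 4) ^ n :=
    fun n => collar_pow_le hC hκ hs hRge n
  have hs4 : 0 < s ^ 4 := by positivity
  -- rewriting the envelopes as `s`-free constants over powers of `s`
  have hDsum : Lip * (σ / m₁) * |μ - ν| * (2 * (σ / m₁) + 3) ^ 4 / s ^ 4 =
      (Lip * (σ / m₁) * (2 * (σ / m₁) + 3) ^ 4) * |μ - ν| / s ^ 4 := by ring
  have hSm : M * (2 * σ + 3) ^ 4 / (m₁ * s) ^ 4 = (M * (2 * σ + 3) ^ 4 / m₁ ^ 4) / s ^ 4 := by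
    rw [mul_pow, div_div]
  constructor
  · refine (abs_Q2_dilate_sub_le G r β L H hMv hLip0 hLv hσ.le hvσ hδ₀.le hv0 hm₁ hμ₁ hμ₂ hν₁ hν₂ hs hs1
      hμs hνs hσL hRδ₀ D₁ D₂ hD₁ hD₂).trans ?_
    rw [hDsum, hSm]
    set A' : ℝ := Lip * (σ / m₁) * (2 * (σ / m₁) + 3) ^ 4
    set B' : ℝ := M * (2 * σ + 3) ^ 4 / m₁ ^ 4
    have hA'0 : 0 ≤ A' := by positivity
    have hB'0 : 0 ≤ B' := by positivity
    have e1 : (C / (R : ℝ) ^ 4) ^ 2 * (2 * (A' * |μ - ν| / s ^ 4 * (B' / s ^ 4))) =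
        ((C / (R : ℝ) ^ 4) ^ 2 / (s ^ 4) ^ 2) * ((2 * (A' * B')) * |μ - ν|) := by
      field_simp
    rw [e1]
    have hq : (C / (R : ℝ) ^ 4) ^ 2 / (s ^ 4) ^ 2 ≤ (16 * C / κ ^ 4) ^ 2 := by
      rw [div_le_iff₀ (by positivity)]; exact hcol 2
    calc (C / (R : ℝ) ^ 4) ^ 2 / (s ^ 4) ^ 2 * ((2 * (A' * B')) * |μ - ν|)
        ≤ (16 * C / κ ^ 4) ^ 2 * ((2 * (A' * B')) * |μ - ν|) := mul_le_mul_of_nonneg_right hq (by positivity)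
      _ = (16 * C / κ ^ 4) ^ 2 * (2 * (A' * B')) * |μ - ν| := by ring
  · intro hclose
    refine (abs_Q3_dilate_sub_le G r β L H hMf hMg hMh hLip0 hLf hLg hLh hσ.le hfσ hgσ hhσ hfg hgh hfh hδ.le hC
      hm₁ hμ₁ hμ₂ hν₁ hν₂ hclose hs hs1 hμs hνs hσL hRδ D₁ D₂ hD₁ hD₂).trans ?_
    rw [hDsum, hSm]
    set A' : ℝ := Lip * (σ / m₁) * (2 * (σ / m₁) + 3) ^ 4
    set B' : ℝ := M * (2 * σ + 3) ^ 4 / m₁ ^ 4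
    have hA'0 : 0 ≤ A' := by positivity
    have hB'0 : 0 ≤ B' := by positivity
    have e1 : (C / (R : ℝ) ^ 4) ^ 3 * (3 * (A' * |μ - ν| / s ^ 4 * (B' / s ^ 4) ^ 2)) =
        ((C / (R : ℝ) ^ 4) ^ 3 / (s ^ 4) ^ 3) * ((3 * (A' * B' ^ 2)) * |μ - ν|) := by
      field_simp
    rw [e1]
    have hq : (C / (R : ℝ) ^ 4) ^ 3 / (s ^ 4) ^ 3 ≤ (16 * C / κ ^ 4) ^ 3 := by
      rw [div_le_iff₀ (by positivity)]; exact hcol 3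
    calc (C / (R : ℝ) ^ 4) ^ 3 / (s ^ 4) ^ 3 * ((3 * (A' * B' ^ 2)) * |μ - ν|)
        ≤ (16 * C / κ ^ 4) ^ 3 * ((3 * (A' * B' ^ 2)) * |μ - ν|) := mul_le_mul_of_nonneg_right hq (by positivity)
      _ = (16 * C / κ ^ 4) ^ 3 * (3 * (A' * B' ^ 2)) * |μ - ν| := by ring

/-- **The unit modulus from the collar bound.**  Given `MomentBounds G r a'` and compactly supported witnesses (`v` gapped,
`f, g, h` pairwise separated), there are `Mod ≥ 0`, `η₀ > 0`, a smallness `s₀ > 0`, a coupling threshold and volume demands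
`Dm β` such that at every `β` past the threshold with `a' β ≤ s₀`, on every torus `L ≥ Dm β`, for all `μ, ν ∈ [m₁, m₂]`:
`|Q2(μ a'β)(θv, v) − Q2(ν a'β)(θv, v)| ≤ Mod |μ−ν|` and, if `|μ−ν| ≤ η₀`, `||Q3(μ a'β) f g h| − |Q3(ν a'β) f g h|| ≤ Mod |μ−ν|`. [folklore] -/
theorem exists_unit_modulus (r : LatticeRep G) {a' : ℝ → ℝ} (ha'pos : ∀ β, 0 < a' β) (hMB : MomentBounds G r a')
    {v f g h : 𝓢(EuclideanSpace ℝ (Fin 4), ℝ)} {σ δ₀ δ m₁ m₂ : ℝ} (hσ : 0 < σ)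
    (hvσ : tsupport (v : EuclideanSpace ℝ (Fin 4) → ℝ) ⊆ Metric.closedBall 0 σ)
    (hfσ : tsupport (f : EuclideanSpace ℝ (Fin 4) → ℝ) ⊆ Metric.closedBall 0 σ)
    (hgσ : tsupport (g : EuclideanSpace ℝ (Fin 4) → ℝ) ⊆ Metric.closedBall 0 σ)
    (hhσ : tsupport (h : EuclideanSpace ℝ (Fin 4) → ℝ) ⊆ Metric.closedBall 0 σ)
    (hδ₀ : 0 < δ₀) (hv0 : ∀ p : EuclideanSpace ℝ (Fin 4), v p ≠ 0 → δ₀ ≤ p 0) (hδ : 0 < δ)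
    (hfg : ∀ p q : EuclideanSpace ℝ (Fin 4), f p ≠ 0 → g q ≠ 0 → δ ≤ ‖p - q‖)
    (hgh : ∀ p q : EuclideanSpace ℝ (Fin 4), g p ≠ 0 → h q ≠ 0 → δ ≤ ‖p - q‖)
    (hfh : ∀ p q : EuclideanSpace ℝ (Fin 4), f p ≠ 0 → h q ≠ 0 → δ ≤ ‖p - q‖)
    (hm₁ : 0 < m₁) (hm₁₂ : m₁ ≤ m₂) :
    ∃ (Mod η₀ s₀ β₄ : ℝ) (Dm : ℝ → ℕ), 0 ≤ Mod ∧ 0 < η₀ ∧ 0 < s₀ ∧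
      ∀ β : ℝ, β₄ ≤ β → a' β ≤ s₀ → ∀ L : ℕ, Dm β ≤ L → ∀ μ ∈ Icc m₁ m₂, ∀ ν ∈ Icc m₁ m₂,
        |Q2 G r β L (μ * a' β) (thetaTest 4 v) v - Q2 G r β L (ν * a' β) (thetaTest 4 v) v| ≤ Mod * |μ - ν| ∧
        (|μ - ν| ≤ η₀ →
          abs (|Q3 G r β L (μ * a' β) f g h| - |Q3 G r β L (ν * a' β) f g h|) ≤ Mod * |μ - ν|) := by
  obtain ⟨C, β₄, ℓ₄, hℓ₄, hC, HMB⟩ := hMB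
  have hm₂ : 0 < m₂ := hm₁.trans_le hm₁₂
  -- a common sup bound and a common Lipschitz constant of the four witnesses
  obtain ⟨M, hMdef⟩ : ∃ M : ℝ, M = max (max (SchwartzMap.seminorm ℝ 0 0 v) (SchwartzMap.seminorm ℝ 0 0 f))
    (max (SchwartzMap.seminorm ℝ 0 0 g) (SchwartzMap.seminorm ℝ 0 0 h)) := ⟨_, rfl⟩
  have hMw : ∀ {w : 𝓢(EuclideanSpace ℝ (Fin 4), ℝ)}, SchwartzMap.seminorm ℝ 0 0 w ≤ M →
      ∀ y : EuclideanSpace ℝ (Fin 4), |w y| ≤ M := fun hw y => by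
    rw [← Real.norm_eq_abs]; exact (SchwartzMap.norm_le_seminorm ℝ _ y).trans hw
  have hMv : ∀ y : EuclideanSpace ℝ (Fin 4), |v y| ≤ M := hMw (by rw [hMdef]; exact le_max_of_le_left (le_max_left _ _))
  have hMf : ∀ y : EuclideanSpace ℝ (Fin 4), |f y| ≤ M := hMw (by rw [hMdef]; exact le_max_of_le_left (le_max_right _ _))
  have hMg : ∀ y : EuclideanSpace ℝ (Fin 4), |g y| ≤ M := hMw (by rw [hMdef]; exact le_max_of_le_right (le_max_left _ _))
  have hMh : ∀ y : EuclideanSpace ℝ (Fin 4), |h y| ≤ M := hMw (by rw [hMdef]; exact le_max_of_le_right (le_max_right _ _))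
  have hM0 : 0 ≤ M := (abs_nonneg _).trans (hMv 0)
  obtain ⟨Lv, hLv0, hLv⟩ := exists_lipschitz_const v
  obtain ⟨Lf, hLf0, hLf⟩ := exists_lipschitz_const f
  obtain ⟨Lg, hLg0, hLg⟩ := exists_lipschitz_const g
  obtain ⟨Lh, hLh0, hLh⟩ := exists_lipschitz_const h
  obtain ⟨Lip, hLipdef⟩ : ∃ Lip : ℝ, Lip = max (max Lv Lf) (max Lg Lh) := ⟨_, rfl⟩
  have hLip0 : 0 ≤ Lip := by rw [hLipdef]; exact hLv0.trans (le_max_of_le_left (le_max_left _ _))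
  have hLw : ∀ {w : 𝓢(EuclideanSpace ℝ (Fin 4), ℝ)} {Lw : ℝ}, Lw ≤ Lip →
      (∀ x y : EuclideanSpace ℝ (Fin 4), |w x - w y| ≤ Lw * ‖x - y‖) →
      ∀ x y : EuclideanSpace ℝ (Fin 4), |w x - w y| ≤ Lip * ‖x - y‖ :=
    fun hle hw x y => (hw x y).trans (mul_le_mul_of_nonneg_right hle (norm_nonneg _))
  have hLv' := hLw (by rw [hLipdef]; exact le_max_of_le_left (le_max_left _ _)) hLv
  have hLf' := hLw (by rw [hLipdef]; exact le_max_of_le_left (le_max_right _ _)) hLf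
  have hLg' := hLw (by rw [hLipdef]; exact le_max_of_le_right (le_max_left _ _)) hLg
  have hLh' := hLw (by rw [hLipdef]; exact le_max_of_le_right (le_max_right _ _)) hLh
  -- the constants
  obtain ⟨κ, hκdef⟩ : ∃ κ : ℝ, κ = min ℓ₄ (min (δ₀ / m₂) (δ / (8 * m₂))) := ⟨_, rfl⟩
  have hκ0 : 0 < κ := by rw [hκdef]; exact lt_min hℓ₄ (lt_min (by positivity) (by positivity))
  have hκℓ : κ ≤ ℓ₄ := by rw [hκdef]; exact min_le_left _ _
  have hκδ₀ : κ ≤ δ₀ / m₂ := by rw [hκdef]; exact (min_le_right _ _).trans (min_le_left _ _)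
  have hκδ : κ ≤ δ / (8 * m₂) := by rw [hκdef]; exact (min_le_right _ _).trans (min_le_right _ _)
  obtain ⟨s₀, hs₀def⟩ : ∃ s₀ : ℝ, s₀ = min 1 (min (κ / 6) (1 / m₂)) := ⟨_, rfl⟩
  have hs₀0 : 0 < s₀ := by rw [hs₀def]; exact lt_min one_pos (lt_min (by positivity) (by positivity))
  have hAB0 : 0 ≤ (Lip * (σ / m₁) * (2 * (σ / m₁) + 3) ^ 4) * (M * (2 * σ + 3) ^ 4 / m₁ ^ 4) := by positivity
  refine ⟨max ((16 * C / κ ^ 4) ^ 2 * (2 * ((Lip * (σ / m₁) * (2 * (σ / m₁) + 3) ^ 4) * (M * (2 * σ + 3) ^ 4 / m₁ ^ 4))))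
      ((16 * C / κ ^ 4) ^ 3 * (3 * ((Lip * (σ / m₁) * (2 * (σ / m₁) + 3) ^ 4) * (M * (2 * σ + 3) ^ 4 / m₁ ^ 4) ^ 2))),
    (δ / 2) / (σ / m₁), s₀, β₄, fun β => max ⌈2 * (σ / m₁) / a' β⌉₊ (4 * (⌊κ / a' β⌋₊ - 2) + 8),
    le_max_of_le_left (by positivity), by positivity, hs₀0, fun β hβ hβs L hL μ hμ ν hν => ?_⟩
  -- the spacing and the collar radius at this coupling
  have hs : 0 < a' β := ha'pos β
  have hs1 : a' β ≤ 1 := hβs.trans (by rw [hs₀def]; exact min_le_left _ _)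
  have h6 : 6 * a' β ≤ κ := by
    have : a' β ≤ κ / 6 := hβs.trans (by rw [hs₀def]; exact (min_le_right _ _).trans (min_le_left _ _))
    rw [le_div_iff₀ (by norm_num : (0 : ℝ) < 6)] at this; linarith
  have hsm₂ : a' β ≤ 1 / m₂ := hβs.trans (by rw [hs₀def]; exact (min_le_right _ _).trans (min_le_right _ _))
  obtain ⟨h1R, hR2, hRge⟩ := collarRadius_spec hs h6
  have hRℓ : ((⌊κ / a' β⌋₊ - 2 : ℕ) : ℝ) * a' β ≤ ℓ₄ := by
    have h0 : ((⌊κ / a' β⌋₊ - 2 : ℕ) : ℝ) * a' β ≤ (((⌊κ / a' β⌋₊ - 2 : ℕ) : ℝ) + 2) * a' β :=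
      mul_le_mul_of_nonneg_right (by linarith) hs.le
    exact h0.trans (hR2.trans hκℓ)
  have h4R : 4 * (⌊κ / a' β⌋₊ - 2) + 8 ≤ L := le_trans (le_max_right _ _) hL
  have H : ∀ (n : ℕ) (x : Fin n → (Fin 4 → ℤ)),
      (∀ i j : Fin n, i ≠ j → ∃ k : Fin 4,
        (2 * ((⌊κ / a' β⌋₊ - 2 : ℕ) : ℤ) + 4) ≤ |((((x i k - x j k : ℤ) : ZMod (2 * L + 1))).valMinAbs : ℤ)|) →
      |torusE G r β L (fun U => ∏ i, (dens G r (x i) U - torusE G r β L (dens G r (x i))))| ≤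
        (C / ((⌊κ / a' β⌋₊ - 2 : ℕ) : ℝ) ^ 4) ^ n :=
    fun n x hsep => HMB β hβ L n x _ h1R hRℓ h4R hsep
  have hσL : 2 * (σ / m₁) ≤ a' β * L := by
    have h1 : ((⌈2 * (σ / m₁) / a' β⌉₊ : ℕ) : ℝ) ≤ L := by exact_mod_cast le_trans (le_max_left _ _) hL
    have h2 : 2 * (σ / m₁) / a' β ≤ L := (Nat.le_ceil _).trans h1
    rw [div_le_iff₀ hs] at h2; linarith
  obtain ⟨hμ₁, hμ₂⟩ := hμ
  obtain ⟨hν₁, hν₂⟩ := hν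
  have hμ0 : 0 < μ := hm₁.trans_le hμ₁
  have hν0 : 0 < ν := hm₁.trans_le hν₁
  have hμs : μ * a' β ≤ 1 := by
    calc μ * a' β ≤ m₂ * (1 / m₂) := mul_le_mul hμ₂ hsm₂ hs.le hm₂.le
      _ = 1 := by field_simp
  have hνs : ν * a' β ≤ 1 := by
    calc ν * a' β ≤ m₂ * (1 / m₂) := mul_le_mul hν₂ hsm₂ hs.le hm₂.le
      _ = 1 := by field_simp
  obtain ⟨D₁, hD₁⟩ := exists_dilation μ hμ0.ne'
  obtain ⟨D₂, hD₂⟩ := exists_dilation ν hν0.ne'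
  obtain ⟨hQ2, hQ3⟩ := unit_modulus_at r β L hC hκ0 H hs hs1 hRge hR2 hMv hMf hMg hMh hLip0 hLv' hLf' hLg' hLh' hσ
    hvσ hfσ hgσ hhσ hδ₀ hv0 hδ hfg hgh hfh hκδ₀ hκδ hm₁ hμ₁ hμ₂ hν₁ hν₂ hμs hνs hσL D₁ D₂ hD₁ hD₂
  constructor
  · rw [← Q2_theta_compCLM D₁ μ hD₁ r β L (a' β) v, ← Q2_theta_compCLM D₂ ν hD₂ r β L (a' β) v]
    exact hQ2.trans (mul_le_mul_of_nonneg_right (le_max_left _ _) (abs_nonneg _))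
  · intro hclose
    have hclose' : |μ - ν| * (σ / m₁) ≤ δ / 2 := by
      rw [le_div_iff₀ (by positivity)] at hclose; exact hclose
    refine (abs_abs_sub_abs_le_abs_sub _ _).trans ?_
    rw [← Q3_compCLM D₁ μ hD₁ r β L (a' β) f g h, ← Q3_compCLM D₂ ν hD₂ r β L (a' β) f g h]
    exact (hQ3 hclose').trans (mul_le_mul_of_nonneg_right (le_max_right _ _) (abs_nonneg _))


end Transfer

end Summit.QuantumFields.YangMills.Cruxes.NT.Subsequential

end
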